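import Literature.Geometry.Symplectic.CompatibleMetric
import Literature.Geometry.Riemannian.IsotropicCurvature
import Literature.Geometry.GaugeTheory.SelfDualFormsSpinors
import HarnessLib

/-!
# The symplectic form is self-dual of length `√2` for the metric `g_J` of a compatible `J`
# (Taubes 1995, §2–§3, §5 Step 1) — frame level

Topic `Literature/Geometry/Symplectic`; continues `CompatibleMetric.lean` (the Riemannian metric
`g_J(v, w) = s(v, Jw)` of an `s`-compatible almost complex structure, `IsCompatibleWith.metric`).

C. H. Taubes, *The Seiberg–Witten and Gromov invariants*, Math. Res. Lett. 2 (1995): §3, pp. 227–228: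
"Note that the assignment of `(v, w)` in `TX` to `ω(v, Jw)` defines a metric on `TX`. For such a
metric, the form `ω` is self-dual."; §2, p. 226: "use a metric for which `ω` is self-dual with
length `√2`"; §5 Step 1, p. 233: "Use a metric on `X` where the symplectic form `ω` is self-dual
with norm `√2`."  In a `g_J`-orthonormal `J`-adapted frame `(e₀, e₁ = Je₀, e₂, e₃ = Je₂)` of a
tangent space (a unitary frame; these are the frames of the canonical `Spin^c` structure of `J`,
`Literature/Geometry/GaugeTheory/AlmostComplexSpincFour.lean`: "`J e₀ = e₁`, `J e₂ = e₃` in each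
frame") the coefficient matrix `Ω_ab = s(e_a, e_b)` of the symplectic form is COMPUTED:

* `twoForm_unitaryFrame_eq`: `Ω = e⁰¹ + e²³`, i.e. `Ω = (0 1 0 0; -1 0 0 0; 0 0 0 1; 0 0 -1 0)` —
  the first of the three basic self-dual forms (`ω = dx₁ ∧ dy₁ + dx₂ ∧ dy₂`, the Kähler form of the
  frame, cf. `kaehlerComponent` of `GaugeTheory/KaehlerCurvatureEquation.lean`);
* hence `isSelfDualTwo_twoForm_unitaryFrame`: `⋆Ω = Ω` (**`s` is `g_J`-self-dual**, for the
  orientation of the unitary frame), `sdCoeff Ω = (2, 0, 0)` (`Ω⁺ = Ω` has the single component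
  `Ω₀₁ + Ω₂₃ = 2` along `e⁰¹ + e²³`) and **`|s|² = Σ_{a<b} Ω_ab² = 2`**, `|s| = √2`
  (`normSq_twoForm_unitaryFrame`), and Clifford multiplication by `s` on `S⁺` is `diag(2i, −2i)` in such a frame
  (`plusAction_twoForm_unitaryFrame`: the constants `Λ⁰ = I` are the `−2i`-eigenspace, Taubes 1995 (2.2)).

Pointwise linear algebra over the tree's `IsOrthonormalFrame` (`Riemannian/IsotropicCurvature`) and
`IsTwoForm` / `hodgeStarTwo` / `IsSelfDualTwo` / `sdCoeff` (`GaugeTheory/SelfDualFormsSpinors`); the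
matrix `Matrix.of fun a b ↦ s x ![e a, e b]` is `twoFormMatrix s x e` of
`GaugeTheory/SeibergWittenEquations.lean` (not imported here).  0 named facts.  Also PROVED: **unitary frames exist** at every point when the model space has real
dimension `4` (`exists_unitaryFrame`, pointwise `J`-Gram–Schmidt).  Not here: smooth LOCAL unitary frames,
the comparison of the unitary-frame orientation with the symplectic orientation `s ∧ s > 0`.

## References

* C. H. Taubes, *The Seiberg–Witten and Gromov invariants*, Math. Res. Lett. 2 (1995) 221–238,
  §2 (p. 226), §3 (pp. 227–228), §5 Step 1 (p. 233). [Taubes1995]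
* D. McDuff, D. Salamon, *Introduction to Symplectic Topology*, 3rd ed., OUP (2017), §4.1 (4.1.3).
  [McDuffSalamon2017]
-/

noncomputable section

open scoped Manifold ContDiff
open Literature.Geometry.Kaehler Literature.Geometry.GaugeTheory
open Literature.Geometry.Lorentzian (PseudoRiemannianMetric)

namespace Literature.Geometry.Symplectic

namespace AlmostComplexStructure.IsCompatibleWith

variable {E : Type*} [NormedAddCommGroup E] [InnerProductSpace ℝ E]
  {H : Type*} [TopologicalSpace H] {I : ModelWithCorners ℝ E H}
  {M : Type*} [TopologicalSpace M] [ChartedSpace H M] [IsManifold I ∞ M]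
  {J : AlmostComplexStructure I ∞ M} {s : MForm I M ℝ 2}

/-- Antisymmetry of a `2`-form: `α(v, w) = -α(w, v)`. [folklore] -/
private theorem twoForm_swap' {V : Type*} [AddCommGroup V] [Module ℝ V] [TopologicalSpace V]
    (α : V [⋀^Fin 2]→L[ℝ] ℝ) (v w : V) : α ![v, w] = -α ![w, v] := by
  have h := α.map_swap ![w, v] (show (0 : Fin 2) ≠ 1 by decide)
  have hs : (![w, v] ∘ Equiv.swap (0 : Fin 2) 1) = ![v, w] := by
    funext i
    fin_cases i <;> rfl
  rw [hs] at h
  exact h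

/-- A `2`-form vanishes on the diagonal. [folklore] -/
private theorem twoForm_self' {V : Type*} [AddCommGroup V] [Module ℝ V] [TopologicalSpace V]
    (α : V [⋀^Fin 2]→L[ℝ] ℝ) (v : V) : α ![v, v] = 0 := by
  have h := twoForm_swap' α v v
  linarith

/-- `α(v, -w) = -α(v, w)`. [folklore] -/
private theorem twoForm_neg_right' {V : Type*} [AddCommGroup V] [Module ℝ V] [TopologicalSpace V]
    (α : V [⋀^Fin 2]→L[ℝ] ℝ) (v w : V) : α ![v, -w] = -α ![v, w] := by
  have hl : α ![-w, v] = -α ![w, v] := by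
    rw [← neg_one_smul ℝ w, show α ![(-1 : ℝ) • w, v] = (-1 : ℝ) * α ![w, v] from
      α.toContinuousMultilinearMap.cons_smul _ _ _, neg_one_mul]
  rw [twoForm_swap' α v (-w), hl, twoForm_swap' α w v, neg_neg]

/-- **The symplectic form in a unitary frame is `e⁰¹ + e²³`.**  For a `g_J`-orthonormal frame
`(e₀, e₁, e₂, e₃)` with `e₁ = J e₀`, `e₃ = J e₂`: `s(e_a, e_b)` is the matrix of
`dx₁ ∧ dy₁ + dx₂ ∧ dy₂` (`s(e₀, e₁) = s(e₀, Je₀) = g_J(e₀, e₀) = 1`, `s(e₀, e₃) = g_J(e₀, e₂) = 0`,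
…). [cite: Taubes1995, §3 (pp. 227–228)] -/
theorem twoForm_unitaryFrame_eq (h : J.IsCompatibleWith s) (hs : IsSmoothForm s) (x : M)
    {e : Fin 4 → TangentSpace I x} (he : (h.metric hs).IsOrthonormalFrame x e)
    (h1 : e 1 = J x (e 0)) (h3 : e 3 = J x (e 2)) :
    (Matrix.of fun a b : Fin 4 ↦ s x ![e a, e b]) = !![0, 1, 0, 0; -1, 0, 0, 0; 0, 0, 0, 1; 0, 0, -1, 0] := by
  obtain ⟨hd, ho⟩ := he
  have hJ0 : J x (e 0) = e 1 := h1.symm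
  have hJ2 : J x (e 2) = e 3 := h3.symm
  have hJ3 : J x (e 3) = -e 2 := by rw [h3, J.map_map]
  -- the six entries above the diagonal, from `g_J(v, w) = s(v, Jw)`
  have A01 : s x ![e 0, e 1] = 1 := by
    have h' := hd 0
    rwa [metric_val_apply, hJ0] at h'
  have A23 : s x ![e 2, e 3] = 1 := by
    have h' := hd 2
    rwa [metric_val_apply, hJ2] at h'
  have A03 : s x ![e 0, e 3] = 0 := by
    have h' := ho 0 2 (by decide)
    rwa [metric_val_apply, hJ2] at h'
  have A13 : s x ![e 1, e 3] = 0 := by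
    have h' := ho 1 2 (by decide)
    rwa [metric_val_apply, hJ2] at h'
  have A02 : s x ![e 0, e 2] = 0 := by
    have h' := ho 0 3 (by decide)
    rwa [metric_val_apply, hJ3, twoForm_neg_right', neg_eq_zero] at h'
  have A12 : s x ![e 1, e 2] = 0 := by
    have h' := ho 1 3 (by decide)
    rwa [metric_val_apply, hJ3, twoForm_neg_right', neg_eq_zero] at h'
  -- below the diagonal by antisymmetry, zero on it
  have S10 := twoForm_swap' (s x) (e 1) (e 0)
  have S20 := twoForm_swap' (s x) (e 2) (e 0)
  have S30 := twoForm_swap' (s x) (e 3) (e 0)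
  have S21 := twoForm_swap' (s x) (e 2) (e 1)
  have S31 := twoForm_swap' (s x) (e 3) (e 1)
  have S32 := twoForm_swap' (s x) (e 3) (e 2)
  have D := twoForm_self' (s x)
  ext a b
  fin_cases a <;> fin_cases b <;>
    simp [A01, A23, A03, A13, A02, A12, S10, S20, S30, S21, S31, S32, D]

/-- The matrix of `s` in a unitary frame is a `2`-form matrix (antisymmetric). [folklore] -/
theorem isTwoForm_twoForm_unitaryFrame (h : J.IsCompatibleWith s) (hs : IsSmoothForm s) (x : M)
    {e : Fin 4 → TangentSpace I x} (he : (h.metric hs).IsOrthonormalFrame x e)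
    (h1 : e 1 = J x (e 0)) (h3 : e 3 = J x (e 2)) :
    IsTwoForm (Matrix.of fun a b : Fin 4 ↦ s x ![e a, e b]) := by
  rw [h.twoForm_unitaryFrame_eq hs x he h1 h3, IsTwoForm]
  ext a b
  fin_cases a <;> fin_cases b <;> simp

/-- **`s` is `g_J`-self-dual** (Taubes 1995, §3: "For such a metric, the form `ω` is self-dual"):
in a unitary frame `⋆Ω = Ω`. [cite: Taubes1995, §3 (pp. 227–228)] -/
theorem isSelfDualTwo_twoForm_unitaryFrame (h : J.IsCompatibleWith s) (hs : IsSmoothForm s) (x : M)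
    {e : Fin 4 → TangentSpace I x} (he : (h.metric hs).IsOrthonormalFrame x e)
    (h1 : e 1 = J x (e 0)) (h3 : e 3 = J x (e 2)) :
    IsSelfDualTwo (Matrix.of fun a b : Fin 4 ↦ s x ![e a, e b]) := by
  rw [h.twoForm_unitaryFrame_eq hs x he h1 h3, IsSelfDualTwo, hodgeStarTwo]
  ext a b
  fin_cases a <;> fin_cases b <;> simp

/-- **The self-dual components of `s` in a unitary frame are `(2, 0, 0)`**: `s = s⁺` lies along
`e⁰¹ + e²³` with coefficient `Ω₀₁ + Ω₂₃ = 2` (twice the unit self-dual form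
`(e⁰¹ + e²³)/√2`, i.e. `|s| = √2`). [cite: Taubes1995, §2 (p. 226) and §5 Step 1 (p. 233)] -/
theorem sdCoeff_twoForm_unitaryFrame (h : J.IsCompatibleWith s) (hs : IsSmoothForm s) (x : M)
    {e : Fin 4 → TangentSpace I x} (he : (h.metric hs).IsOrthonormalFrame x e)
    (h1 : e 1 = J x (e 0)) (h3 : e 3 = J x (e 2)) :
    sdCoeff (Matrix.of fun a b : Fin 4 ↦ s x ![e a, e b]) = ![2, 0, 0] := by
  rw [h.twoForm_unitaryFrame_eq hs x he h1 h3, sdCoeff]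
  ext k
  fin_cases k <;> simp [one_add_one_eq_two]

/-- **Clifford multiplication by `s` on `S⁺` in a unitary frame is `diag(2i, −2i)`** — it preserves
the splitting `S⁺ = Λ² ⊕ Λ⁰` of the canonical `Spin^c` structure (first basis line `Λ²_ℂ V ≅ K⁻¹`,
second the constants `Λ⁰ = I`, cf. `AlmostComplexSpincFour`), the trivial summand `I` having
eigenvalue `−2i` (Taubes 1995, §2, the remark after (2.2): "Clifford multiplication by `ω` on `S⁺`
in (2.2) preserves the splitting with the summand `E` having eigenvalue `−2i`", here `E = I`;
Taubes 1994, §1: `S⁺ ≈ I ⊕ K⁻¹` split by `ω`).  Frame level: `ρ⁺(s) = Σ_k sdCoeff_k m(e_{k+1})`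
with `sdCoeff = (2, 0, 0)`. [cite: Taubes1995, §2 (2.2) (p. 226)] -/
theorem plusAction_twoForm_unitaryFrame (h : J.IsCompatibleWith s) (hs : IsSmoothForm s) (x : M)
    {e : Fin 4 → TangentSpace I x} (he : (h.metric hs).IsOrthonormalFrame x e)
    (h1 : e 1 = J x (e 0)) (h3 : e 3 = J x (e 2)) :
    plusAction (Matrix.of fun a b : Fin 4 ↦ s x ![e a, e b]) = !![2 * Complex.I, 0; 0, -(2 * Complex.I)] := by
  rw [plusAction, h.sdCoeff_twoForm_unitaryFrame hs x he h1 h3]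
  ext a b
  fin_cases a <;> fin_cases b <;> simp [suTwoBasis, Fin.sum_univ_three]

/-- **`|s|² = 2` for `g_J`** ("self-dual with norm `√2`", Taubes 1995, §5 Step 1): the squared
pointwise norm `Σ_{a<b} s(e_a, e_b)²` in a unitary (hence in any `g_J`-orthonormal) frame is `2`.
[cite: Taubes1995, §5 Step 1 (p. 233)] -/
theorem normSq_twoForm_unitaryFrame (h : J.IsCompatibleWith s) (hs : IsSmoothForm s) (x : M)
    {e : Fin 4 → TangentSpace I x} (he : (h.metric hs).IsOrthonormalFrame x e)
    (h1 : e 1 = J x (e 0)) (h3 : e 3 = J x (e 2)) :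
    (s x ![e 0, e 1]) ^ 2 + (s x ![e 0, e 2]) ^ 2 + (s x ![e 0, e 3]) ^ 2 +
      (s x ![e 1, e 2]) ^ 2 + (s x ![e 1, e 3]) ^ 2 + (s x ![e 2, e 3]) ^ 2 = 2 := by
  have hm := h.twoForm_unitaryFrame_eq hs x he h1 h3
  have hab : ∀ a b : Fin 4, s x ![e a, e b] =
      (!![0, 1, 0, 0; -1, 0, 0, 0; 0, 0, 0, 1; 0, 0, -1, 0] : Matrix (Fin 4) (Fin 4) ℝ) a b := fun a b ↦ by
    rw [← hm]; rfl
  simp [hab, one_add_one_eq_two]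

/-! ### Unitary frames exist (pointwise `J`-Gram–Schmidt in real dimension `4`) -/

/-- Normalising a non-zero vector for `g_J`: `g_J(v, v) > 0`, and `u := g_J(v, v)^{-1/2} v` has
`g_J(u, u) = 1`. [folklore] -/
theorem metric_val_normalize (h : J.IsCompatibleWith s) (hs : IsSmoothForm s) (x : M)
    {v : TangentSpace I x} (hv : v ≠ 0) :
    (h.metric hs).val x ((Real.sqrt ((h.metric hs).val x v v))⁻¹ • v)
      ((Real.sqrt ((h.metric hs).val x v v))⁻¹ • v) = 1 := by
  set c := (h.metric hs).val x v v with hc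
  have hcpos : 0 < c := h.metric_val_self_pos hs x hv
  have e1 : (h.metric hs).val x ((Real.sqrt c)⁻¹ • v) = (Real.sqrt c)⁻¹ • (h.metric hs).val x v :=
    map_smul _ _ _
  rw [e1, FunLike.coe_smul, Pi.smul_apply, map_smul, smul_eq_mul, smul_eq_mul, ← hc,
    ← mul_assoc, ← mul_inv, Real.mul_self_sqrt hcpos.le, inv_mul_cancel₀ hcpos.ne']

/-- `g_J(v, Jv) = 0`: a vector is `g_J`-orthogonal to its `J`-rotate (`J` is `g_J`-skew).
[cite: McDuffSalamon2017, §4.1 (4.1.2)] -/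
theorem metric_val_self_map (h : J.IsCompatibleWith s) (hs : IsSmoothForm s) (x : M)
    (v : TangentSpace I x) : (h.metric hs).val x v (J x v) = 0 := by
  have h1 := h.metric_val_map_right hs x v v
  have h2 := (h.metric hs).symm x (J x v) v
  linarith

/-- **Unitary frames exist** at every point of an almost Kähler `4`-manifold: there is a
`g_J`-orthonormal frame `(e₀, e₁ = Je₀, e₂, e₃ = Je₂)` of `T_x M` (`J`-Gram–Schmidt: normalise any
`v ≠ 0`, add `Jv`, pick `w ≠ 0` `g_J`-orthogonal to both — possible as `4 > 2` — normalise, add `Jw`;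
Morgan 1996, Cor. 3.4.5: the unitary reduction of the frame bundle determined by `(g, J)`).
[cite: MorganSWBook1996, Cor. 3.4.5] [cite: Taubes1995, §5 Step 1 (p. 233)] -/
theorem exists_unitaryFrame [FiniteDimensional ℝ E] (h4 : Module.finrank ℝ E = 4)
    (h : J.IsCompatibleWith s) (hs : IsSmoothForm s) (x : M) :
    ∃ e : Fin 4 → TangentSpace I x,
      (h.metric hs).IsOrthonormalFrame x e ∧ e 1 = J x (e 0) ∧ e 3 = J x (e 2) := by
  haveI : FiniteDimensional ℝ (TangentSpace I x) := ‹FiniteDimensional ℝ E›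
  have h4' : Module.finrank ℝ (TangentSpace I x) = 4 := h4
  set g := (h.metric hs).val x with hg
  -- a first unit vector and its `J`-rotate
  obtain ⟨v, hv⟩ :=
    (Module.finrank_pos_iff_exists_ne_zero (R := ℝ) (M := TangentSpace I x)).1 (by omega)
  set e₀ : TangentSpace I x := (Real.sqrt (g v v))⁻¹ • v with he₀
  have n0 : g e₀ e₀ = 1 := h.metric_val_normalize hs x hv
  have n1 : g (J x e₀) (J x e₀) = 1 := by rw [hg, h.metric_val_map_map hs x]; exact n0
  have o01 : g e₀ (J x e₀) = 0 := h.metric_val_self_map hs x e₀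
  have o10 : g (J x e₀) e₀ = 0 := by rw [hg, (h.metric hs).symm x]; exact o01
  -- a non-zero vector `g`-orthogonal to `e₀` and `Je₀` (the kernel of a map to `ℝ²` from `ℝ⁴`)
  let φ : TangentSpace I x →ₗ[ℝ] (Fin 2 → ℝ) :=
    LinearMap.pi fun k : Fin 2 ↦ ((g (![e₀, J x e₀] k)).toLinearMap : TangentSpace I x →ₗ[ℝ] ℝ)
  have hker : LinearMap.ker φ ≠ ⊥ :=
    LinearMap.ker_ne_bot_of_finrank_lt (by rw [h4', Module.finrank_fin_fun]; norm_num)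
  obtain ⟨w, hwker, hw⟩ := Submodule.exists_mem_ne_zero_of_ne_bot hker
  have hw0 : g e₀ w = 0 := by
    have := congr_fun (LinearMap.mem_ker.1 hwker) 0
    simpa [φ] using this
  have hw1 : g (J x e₀) w = 0 := by
    have := congr_fun (LinearMap.mem_ker.1 hwker) 1
    simpa [φ] using this
  set e₂ : TangentSpace I x := (Real.sqrt (g w w))⁻¹ • w with he₂
  have n2 : g e₂ e₂ = 1 := h.metric_val_normalize hs x hw
  have n3 : g (J x e₂) (J x e₂) = 1 := by rw [hg, h.metric_val_map_map hs x]; exact n2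
  have o02 : g e₀ e₂ = 0 := by rw [he₂, map_smul, hw0, smul_zero]
  have o12 : g (J x e₀) e₂ = 0 := by rw [he₂, map_smul, hw1, smul_zero]
  have o20 : g e₂ e₀ = 0 := by rw [hg, (h.metric hs).symm x]; exact o02
  have o21 : g e₂ (J x e₀) = 0 := by rw [hg, (h.metric hs).symm x]; exact o12
  have o03 : g e₀ (J x e₂) = 0 := by rw [hg, h.metric_val_map_right hs x, ← hg, o12, neg_zero]
  have o30 : g (J x e₂) e₀ = 0 := by rw [hg, (h.metric hs).symm x]; exact o03
  have o13 : g (J x e₀) (J x e₂) = 0 := by rw [hg, h.metric_val_map_map hs x, ← hg, o02]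
  have o31 : g (J x e₂) (J x e₀) = 0 := by rw [hg, (h.metric hs).symm x]; exact o13
  have o23 : g e₂ (J x e₂) = 0 := h.metric_val_self_map hs x e₂
  have o32 : g (J x e₂) e₂ = 0 := by rw [hg, (h.metric hs).symm x]; exact o23
  refine ⟨![e₀, J x e₀, e₂, J x e₂], ⟨fun i ↦ ?_, fun i j hij ↦ ?_⟩, rfl, rfl⟩
  · fin_cases i <;> [exact n0; exact n1; exact n2; exact n3]
  · fin_cases i <;> fin_cases j <;>
      [exact absurd rfl hij; exact o01; exact o02; exact o03;
       exact o10; exact absurd rfl hij; exact o12; exact o13;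
       exact o20; exact o21; exact absurd rfl hij; exact o23;
       exact o30; exact o31; exact o32; exact absurd rfl hij]

end AlmostComplexStructure.IsCompatibleWith

end Literature.Geometry.Symplectic

end
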